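import Mathlib
import Literature.NumberTheory.ModularForms.LevelThreeForms
import Literature.Analysis.SpecialFunctions.JacobiThetaEtaQuotient
import HarnessLib

/-!
# The level-`3` eta quotient `t = (η(τ)/η(3τ))¹²`

[topic NumberTheory/ModularForms]

Support for the level-3 case of Zhou 2015, Remark 9: the Hauptmodul-type eta quotient
`t(τ) := (η(τ)/η(3τ))¹²` of `Γ₀(3)` (`tThree`), built from Mathlib's Dedekind `η`:

* `tThree_vadd_one : t(τ+1) = t(τ)`, `tThree_fricke : t(−1/(3τ))·t(τ) = 729`;
* **`t' = −2πi 𝓟 t`** through `ofComplex` (`hasDerivAt_tThree_ofComplex`; from Mathlib's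
  `logDeriv η = (πi/12)E₂`), i.e. `Dt = −𝓟t` with `𝓟 = (3E₂(3τ) − E₂(τ))/2 = eisThree`;
* `t = e^{−2πiτ}·(∏(1−qⁿ)/∏(1−q³ⁿ))¹²` (`tThree_eq`), the eta product tends to `1` at `i∞`
  (`tendsto_eta_tprod_atImInfty`), hence **`e^{2πiτ} t → 1`** (`tendsto_q_mul_tThree`);
* on the imaginary axis `t(iy)` is real and positive (`tThree_axisPt`), `t(i/√3) = 27`
  (`tThree_axisPt_inv_sqrt_three`), and at the corner **`t(c₃) = −27`** (`tThree_cmLevelThree`).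

## References
* Zhou 2015, Remark 9 (level `3`). [cite: Zhou2015, Remark 9]
* the eta quotient `(η(τ)/η(3τ))¹²` as Hauptmodul of `Γ₀(3)`. [folklore]
-/

noncomputable section

open Complex hiding I
open UpperHalfPlane hiding I
open Filter Topology ModularForm EisensteinSeries Real
open scoped MatrixGroups ModularForm Manifold

namespace Literature.NumberTheory.ModularForms

open Literature.NumberTheory.EllipticCurves.ModularForms (eta_S_smul csqrt_sq eta_add_one mulThree coe_mulThree
  axisPt coe_axisPt im_axisPt)
open Literature.NumberTheory.Automorphic (cmLevelThree)

/-! ## The eta product at `i∞` and at points with real nome -/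

/-- `∏(1 − q^{n+1}) → 1` as `q → 0` (Mathlib's argument for the 24th power). [folklore] -/
theorem tendsto_eta_tprod_nhds_zero : Tendsto (fun q : ℂ ↦ ∏' (n : ℕ), (1 - q ^ (n + 1))) (𝓝 0) (𝓝 1) := by
  have := tendsto_tprod_one_add_of_dominated_convergence (𝓕 := 𝓝 0) (g := 0)
    (f := fun (q : ℂ) (n : ℕ) ↦ -q ^ (n + 1)) (bound := fun n ↦ (1 / 2 : ℝ) ^ (n + 1))
  simp only [Pi.zero_apply, norm_neg, norm_pow, add_zero, tprod_one] at this
  simp_rw [sub_eq_add_neg]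
  refine this
    (by simpa only [pow_succ'] using (summable_geometric_of_abs_lt_one (by norm_num)).mul_left _)
    (fun k ↦ by simpa using ((continuous_pow (M := ℂ) (k + 1)).tendsto 0).neg) ?_
  filter_upwards [Metric.ball_mem_nhds (0 : ℂ) (by norm_num : (0 : ℝ) < 1 / 2)] with q hq k
  exact pow_le_pow_left₀ (norm_nonneg _) (mem_ball_zero_iff.mp hq).le _

/-- **`∏(1 − e^{2πi(n+1)τ}) → 1` at `i∞`.** [folklore] -/
theorem tendsto_eta_tprod_atImInfty : Tendsto (fun τ : ℍ ↦ ∏' (n : ℕ), (1 - eta_q n (τ : ℂ))) atImInfty (𝓝 1) := by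
  have h := tendsto_eta_tprod_nhds_zero.comp (UpperHalfPlane.qParam_tendsto_atImInfty zero_lt_one)
  refine h.congr fun τ => ?_
  simp only [Function.comp_apply, ModularForm.eta_q_eq_pow, Function.Periodic.qParam, Complex.ofReal_one, div_one]

/-- The eta product `∏(1 − e^{2πi(n+1)z})` is real and positive when the nome `e^{2πiz}` is real
(`Im z > 0`). [folklore] -/
theorem eta_tprod_real_pos {z : ℂ} (hz : 0 < z.im) {r : ℝ} (hq : cexp (2 * π * Complex.I * z) = (r : ℂ)) :
    (∏' n : ℕ, (1 - eta_q n z)).im = 0 ∧ 0 < (∏' n : ℕ, (1 - eta_q n z)).re := by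
  have hzs : z ∈ upperHalfPlaneSet := hz
  have hr1 : |r| < 1 := by
    have h1 : ‖cexp (2 * π * Complex.I * z)‖ < 1 := by
      simpa [mul_comm] using UpperHalfPlane.norm_exp_two_pi_I_lt_one ⟨z, hz⟩
    rw [hq, Complex.norm_real, Real.norm_eq_abs] at h1
    exact h1
  have hfac : ∀ n : ℕ, 1 - eta_q n z = ((1 - r ^ (n + 1) : ℝ) : ℂ) := by
    intro n; rw [ModularForm.eta_q_eq_pow, hq]; push_cast; ring
  have hfac_pos : ∀ n : ℕ, 0 < 1 - r ^ (n + 1) := by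
    intro n
    have : |r ^ (n + 1)| < 1 := by rw [abs_pow]; exact pow_lt_one₀ (abs_nonneg _) hr1 (Nat.succ_ne_zero _)
    linarith [(abs_lt.mp this).2]
  have hmul : Multipliable fun n : ℕ => 1 - eta_q n z :=
    (ModularForm.multipliableLocallyUniformlyOn_eta.multipliable hzs)
  have hlim := hmul.tendsto_prod_tprod_nat
  have hpart : ∀ N : ℕ, (∏ n ∈ Finset.range N, (1 - eta_q n z)) = ((∏ n ∈ Finset.range N, (1 - r ^ (n + 1)) : ℝ) : ℂ) := by
    intro N; rw [Complex.ofReal_prod]; exact Finset.prod_congr rfl fun n _ => hfac n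
  have him : (∏' n : ℕ, (1 - eta_q n z)).im = 0 := by
    have h := (Complex.continuous_im.tendsto _).comp hlim
    have h0 : (Complex.im ∘ fun N : ℕ => ∏ n ∈ Finset.range N, (1 - eta_q n z)) = fun _ => 0 := by
      funext N; simp only [Function.comp_apply, hpart, Complex.ofReal_im]
    rw [h0] at h
    exact tendsto_nhds_unique h tendsto_const_nhds
  have hre : 0 ≤ (∏' n : ℕ, (1 - eta_q n z)).re := by
    have h := (Complex.continuous_re.tendsto _).comp hlim
    refine ge_of_tendsto' h fun N => ?_
    simp only [Function.comp_apply, hpart, Complex.ofReal_re]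
    exact Finset.prod_nonneg fun n _ => (hfac_pos n).le
  have hne : (∏' n : ℕ, (1 - eta_q n z)) ≠ 0 := ModularForm.eta_tprod_ne_zero hzs
  exact ⟨him, lt_of_le_of_ne hre fun h0 => hne (Complex.ext (by rw [← h0]; rfl) (by rw [him]; rfl))⟩

/-! ## The eta quotient `t = (η/η₃)¹²` -/

/-- The eta product `P(z) := ∏(1 − e^{2πi(n+1)z})`. [folklore] -/
def etaProd (z : ℂ) : ℂ := ∏' n : ℕ, (1 - eta_q n z)

/-- `η = 𝕢₂₄ · P`. [folklore] -/
theorem eta_eq_qParam_mul_etaProd (z : ℂ) : η z = Function.Periodic.qParam 24 z * etaProd z := rfl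

/-- **`t(τ) := (η(τ)/η(3τ))¹²`.** [folklore] -/
def tThree (τ : ℍ) : ℂ := (η (τ : ℂ) / η ((mulThree τ : ℍ) : ℂ)) ^ 12

/-- `t ≠ 0`. [folklore] -/
theorem tThree_ne_zero (τ : ℍ) : tThree τ ≠ 0 :=
  pow_ne_zero _ (div_ne_zero (ModularForm.eta_ne_zero τ.2) (ModularForm.eta_ne_zero (mulThree τ).2))

/-- `(𝕢₂₄ τ)¹²/(𝕢₂₄ (3τ))¹² = e^{−2πiτ}`. [folklore] -/
theorem qParam_pow_twelve_div (τ : ℍ) :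
    (Function.Periodic.qParam 24 (τ : ℂ)) ^ 12 / (Function.Periodic.qParam 24 ((mulThree τ : ℍ) : ℂ)) ^ 12 =
      cexp (-(2 * π * Complex.I * τ)) := by
  rw [Function.Periodic.qParam, Function.Periodic.qParam, ← Complex.exp_nat_mul, ← Complex.exp_nat_mul, ← Complex.exp_sub,
    coe_mulThree]
  congr 1
  push_cast
  ring

/-- **`t = e^{−2πiτ} (P(τ)/P(3τ))¹²`.** [folklore] -/
theorem tThree_eq (τ : ℍ) :
    tThree τ = cexp (-(2 * π * Complex.I * τ)) * (etaProd (τ : ℂ) / etaProd ((mulThree τ : ℍ) : ℂ)) ^ 12 := by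
  rw [tThree, eta_eq_qParam_mul_etaProd, eta_eq_qParam_mul_etaProd, mul_div_mul_comm, mul_pow, div_pow,
    qParam_pow_twelve_div]

/-- **`e^{2πiτ} t(τ) → 1` at `i∞`.** [folklore] -/
theorem tendsto_q_mul_tThree : Tendsto (fun τ : ℍ => cexp (2 * π * Complex.I * τ) * tThree τ) atImInfty (𝓝 1) := by
  have h1 : Tendsto (fun τ : ℍ => etaProd (τ : ℂ)) atImInfty (𝓝 1) := tendsto_eta_tprod_atImInfty
  have h3 : Tendsto (fun τ : ℍ => etaProd ((mulThree τ : ℍ) : ℂ)) atImInfty (𝓝 1) :=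
    tendsto_eta_tprod_atImInfty.comp tendsto_mulThree_atImInfty
  have h := (h1.div h3 one_ne_zero).pow 12
  rw [div_one, one_pow] at h
  refine h.congr fun τ => ?_
  simp only [Pi.div_apply]
  rw [tThree_eq, ← mul_assoc, ← Complex.exp_add, add_neg_cancel, Complex.exp_zero, one_mul]

/-- **`t(τ + 1) = t(τ)`.** [folklore] -/
theorem tThree_vadd_one (τ : ℍ) : tThree ((1 : ℝ) +ᵥ τ) = tThree τ := by
  rw [tThree, tThree]
  have h1 : (((1 : ℝ) +ᵥ τ : ℍ) : ℂ) = (τ : ℂ) + 1 := by rw [UpperHalfPlane.coe_vadd]; push_cast; ring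
  have h3 : ((mulThree ((1 : ℝ) +ᵥ τ) : ℍ) : ℂ) = ((mulThree τ : ℍ) : ℂ) + 3 := by
    rw [coe_mulThree, coe_mulThree, UpperHalfPlane.coe_vadd]; push_cast; ring
  have hexp : (cexp (2 * π * Complex.I / 24) / cexp (2 * π * Complex.I / 24) ^ 3) ^ 12 = 1 := by
    have h1 : cexp (2 * π * Complex.I / 24) / cexp (2 * π * Complex.I / 24) ^ 3 = cexp (-2 * (2 * π * Complex.I / 24)) := by
      rw [← Complex.exp_nat_mul, ← Complex.exp_sub]; congr 1; push_cast; ring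
    rw [h1, ← Complex.exp_nat_mul, show ((12 : ℕ) : ℂ) * (-2 * (2 * π * Complex.I / 24)) = (-1 : ℤ) * (2 * π * Complex.I) by
      push_cast; ring, Complex.exp_int_mul_two_pi_mul_I]
  rw [h1, h3, eta_add_one, eta_add_three, mul_div_mul_comm, mul_pow, hexp, one_mul]

/-- **`t(−1/(3τ)) · t(τ) = 729`** (`η(−1/(3τ)) = e^{−πi/4}√(3τ)η(3τ)`, `η(−1/τ) = e^{−πi/4}√τ η(τ)`). [folklore] -/
theorem tThree_fricke (τ : ℍ) : tThree (frickeThree τ) * tThree τ = 729 := by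
  rw [tThree, tThree, mulThree_frickeThree, frickeThree_eq_S_smul, eta_S_smul, eta_S_smul, coe_mulThree]
  have hτ : (τ : ℂ) ≠ 0 := τ.ne_zero
  have hη : η (τ : ℂ) ≠ 0 := ModularForm.eta_ne_zero τ.2
  have hη3 : η (3 * (τ : ℂ)) ≠ 0 := by
    have := ModularForm.eta_ne_zero (mulThree τ).2; rwa [coe_mulThree] at this
  have he : cexp (-(π * Complex.I / 4)) ≠ 0 := Complex.exp_ne_zero _
  have hs1 : Complex.sqrt (τ : ℂ) ≠ 0 := by
    intro h; have := congrArg (· ^ 2) h; simp [csqrt_sq, hτ] at this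
  have hs3 : Complex.sqrt (3 * (τ : ℂ)) ≠ 0 := by
    intro h; have := congrArg (· ^ 2) h; simp [csqrt_sq, hτ] at this
  have h3 : Complex.sqrt (3 * (τ : ℂ)) ^ 12 = (3 * (τ : ℂ)) ^ 6 := by
    rw [show (12 : ℕ) = 2 * 6 from rfl, pow_mul, csqrt_sq]
  have h1 : Complex.sqrt (τ : ℂ) ^ 12 = (τ : ℂ) ^ 6 := by
    rw [show (12 : ℕ) = 2 * 6 from rfl, pow_mul, csqrt_sq]
  rw [div_pow, div_pow, mul_pow, mul_pow, mul_pow, mul_pow, h3, h1]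
  field_simp
  ring

/-! ## The derivative: `t' = −2πi 𝓟 t` -/

/-- `deriv η z = (πi/12) E₂(z) η(z)` on `ℍ` (Mathlib's logarithmic derivative). [folklore] -/
theorem hasDerivAt_eta {z : ℂ} (hz : 0 < z.im) :
    HasDerivAt η (π * Complex.I / 12 * E2 (ofComplex z) * η z) z := by
  have hd : DifferentiableAt ℂ η z := ModularForm.differentiableAt_eta_of_mem_upperHalfPlaneSet hz
  refine hd.hasDerivAt.congr_deriv ?_
  have h := ModularForm.logDeriv_eta_eq_E2 ⟨z, hz⟩
  rw [logDeriv_apply, div_eq_iff (ModularForm.eta_ne_zero hz)] at h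
  have hz' : (ofComplex z : ℍ) = ⟨z, hz⟩ := by
    apply UpperHalfPlane.ext; rw [ofComplex_apply_of_im_pos hz]
  rw [hz']
  exact h

/-- **`(t ∘ ofComplex)' = −2πi·𝓟·t`.** [folklore] -/
theorem hasDerivAt_tThree_ofComplex {w : ℂ} (hw : 0 < w.im) :
    HasDerivAt (tThree ∘ ofComplex) (-(2 * π * Complex.I) * (eisThree ∘ ofComplex) w * (tThree ∘ ofComplex) w) w := by
  have hw3 : 0 < (3 * w).im := by simpa using hw
  have h1 := hasDerivAt_eta hw
  have hlin : HasDerivAt (fun u : ℂ => 3 * u) 3 w := ((hasDerivAt_id' w).const_mul (3 : ℂ)).congr_deriv (mul_one _)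
  have h3 : HasDerivAt (fun u : ℂ => η (3 * u)) (π * Complex.I / 12 * E2 (ofComplex (3 * w)) * η (3 * w) * 3) w :=
    (hasDerivAt_eta hw3).comp w hlin
  have hη : η w ≠ 0 := ModularForm.eta_ne_zero hw
  have hη3 : η (3 * w) ≠ 0 := ModularForm.eta_ne_zero hw3
  have hquot := (h1.div h3 hη3).pow 12
  have hev : (tThree ∘ ofComplex) =ᶠ[𝓝 w] fun u => (η u / η (3 * u)) ^ 12 := by
    filter_upwards [isOpen_upperHalfPlaneSet.mem_nhds hw] with u hu
    simp only [Function.comp_apply, tThree, coe_mulThree, ofComplex_apply_of_im_pos hu]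
  have hfinal := hquot.congr_of_eventuallyEq hev
  have e3 : ((mulThree (ofComplex w) : ℍ) : ℂ) = 3 * w := by rw [coe_mulThree, ofComplex_apply_of_im_pos hw]
  have eo : mulThree (ofComplex w) = ofComplex (3 * w) := mulThree_ofComplex hw
  have ht : (tThree ∘ ofComplex) w = (η w / η (3 * w)) ^ 12 := by
    rw [Function.comp_apply, tThree, e3, ofComplex_apply_of_im_pos hw]
  have hP : (eisThree ∘ ofComplex) w = (3 * E2 (ofComplex (3 * w)) - E2 (ofComplex w)) / 2 := by
    rw [Function.comp_apply, eisThree, eo]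
  rw [ht, hP]
  refine hfinal.congr_deriv ?_
  rw [Pi.div_apply]
  norm_num
  field_simp
  ring

/-! ## Values on the imaginary axis and at the corner -/

/-- `t(iy)` is real and positive. [folklore] -/
theorem tThree_axisPt {y : ℝ} (hy : 0 < y) : ∃ r : ℝ, 0 < r ∧ tThree (axisPt y) = (r : ℂ) := by
  have h3y : 0 < 3 * y := by positivity
  have hc1 : ((axisPt y : ℍ) : ℂ) = Complex.I * y := by rw [coe_axisPt hy, mul_comm]
  have hc3 : ((mulThree (axisPt y) : ℍ) : ℂ) = Complex.I * ((3 * y : ℝ) : ℂ) := by rw [coe_mulThree, coe_axisPt hy]; push_cast; ring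
  rw [tThree, hc1, hc3, Literature.Analysis.SpecialFunctions.eta_I_mul_eq_norm hy,
    Literature.Analysis.SpecialFunctions.eta_I_mul_eq_norm h3y]
  have h1 : 0 < ‖η (Complex.I * y)‖ := norm_pos_iff.mpr (ModularForm.eta_ne_zero (by simp [hy]))
  have h3 : 0 < ‖η (Complex.I * ((3 * y : ℝ) : ℂ))‖ := norm_pos_iff.mpr (ModularForm.eta_ne_zero (by simp [h3y]))
  refine ⟨(‖η (Complex.I * y)‖ / ‖η (Complex.I * ((3 * y : ℝ) : ℂ))‖) ^ 12, by positivity, ?_⟩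
  push_cast; ring

/-- `W₃` fixes `i/√3`. [folklore] -/
theorem frickeThree_axisPt_inv_sqrt_three : frickeThree (axisPt (1 / Real.sqrt 3)) = axisPt (1 / Real.sqrt 3) := by
  have hs : 0 < Real.sqrt 3 := Real.sqrt_pos.mpr (by norm_num)
  have h0 : (0 : ℝ) < 1 / Real.sqrt 3 := by positivity
  apply UpperHalfPlane.ext
  rw [coe_frickeThree, coe_axisPt h0]
  have hs' : (Real.sqrt 3 : ℂ) ≠ 0 := by exact_mod_cast hs.ne'
  have hss : (Real.sqrt 3 : ℂ) * Real.sqrt 3 = 3 := by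
    have := Real.mul_self_sqrt (show (0:ℝ) ≤ 3 by norm_num); exact_mod_cast this
  push_cast
  field_simp
  rw [Complex.I_sq]
  linear_combination -hss

/-- **`t(i/√3) = 27`.** [folklore] -/
theorem tThree_axisPt_inv_sqrt_three : tThree (axisPt (1 / Real.sqrt 3)) = 27 := by
  have h0 : (0 : ℝ) < 1 / Real.sqrt 3 := by positivity
  obtain ⟨r, hr, hreq⟩ := tThree_axisPt h0
  have hsq : tThree (axisPt (1 / Real.sqrt 3)) ^ 2 = 729 := by
    have := tThree_fricke (axisPt (1 / Real.sqrt 3))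
    rw [frickeThree_axisPt_inv_sqrt_three] at this
    rw [sq]; exact this
  rw [hreq] at hsq ⊢
  have hr2 : r ^ 2 = 729 := by exact_mod_cast hsq
  have : r = 27 := by nlinarith
  rw [this]; norm_num

/-- The nome at the corner: `e^{−2πi c₃} = −e^{π√3/3}` (real, negative). [folklore] -/
theorem cexp_neg_cmLevelThree : cexp (-(2 * π * Complex.I * ((cmLevelThree : ℍ) : ℂ))) = ((-Real.exp (π * Real.sqrt 3 / 3) : ℝ) : ℂ) := by
  rw [coe_cmLevelThree]
  have h : -(2 * π * Complex.I * (⟨1 / 2, Real.sqrt 3 / 6⟩ : ℂ)) = ((π * Real.sqrt 3 / 3 : ℝ) : ℂ) + (-1 : ℤ) * (2 * π * Complex.I) + π * Complex.I := by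
    apply Complex.ext <;> simp <;> ring
  rw [h, Complex.exp_add, Complex.exp_add, Complex.exp_int_mul_two_pi_mul_I, Complex.exp_pi_mul_I]
  push_cast; ring

/-- The nomes `e^{2πi c₃}` and `e^{2πi·3c₃}` are real. [folklore] -/
theorem cexp_cmLevelThree_real :
    cexp (2 * π * Complex.I * ((cmLevelThree : ℍ) : ℂ)) = ((-Real.exp (-(π * Real.sqrt 3 / 3)) : ℝ) : ℂ) ∧
      cexp (2 * π * Complex.I * ((mulThree cmLevelThree : ℍ) : ℂ)) = ((-Real.exp (-(π * Real.sqrt 3)) : ℝ) : ℂ) := by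
  constructor
  · rw [coe_cmLevelThree]
    have h : 2 * π * Complex.I * (⟨1 / 2, Real.sqrt 3 / 6⟩ : ℂ) = ((-(π * Real.sqrt 3 / 3) : ℝ) : ℂ) + π * Complex.I := by
      apply Complex.ext <;> simp <;> ring
    rw [h, Complex.exp_add, Complex.exp_pi_mul_I]; push_cast; ring
  · rw [coe_mulThree, coe_cmLevelThree]
    have h : 2 * π * Complex.I * (3 * (⟨1 / 2, Real.sqrt 3 / 6⟩ : ℂ)) = ((-(π * Real.sqrt 3) : ℝ) : ℂ) + (1 : ℤ) * (2 * π * Complex.I) + π * Complex.I := by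
      have hs : Real.sqrt 3 * Real.sqrt 3 = 3 := Real.mul_self_sqrt (by norm_num)
      apply Complex.ext <;> simp <;> ring
    rw [h, Complex.exp_add, Complex.exp_add, Complex.exp_int_mul_two_pi_mul_I, Complex.exp_pi_mul_I]
    push_cast; ring

/-- `W₃ c₃ = c₃ − 1`. [folklore] -/
theorem frickeThree_cmLevelThree' : frickeThree cmLevelThree = (-1 : ℝ) +ᵥ cmLevelThree := by
  apply UpperHalfPlane.ext
  rw [coe_frickeThree, UpperHalfPlane.coe_vadd, coe_cmLevelThree]
  have hs : Real.sqrt 3 * Real.sqrt 3 = 3 := Real.mul_self_sqrt (by norm_num)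
  have hne : (3 : ℂ) * (⟨1 / 2, Real.sqrt 3 / 6⟩ : ℂ) ≠ 0 := by
    intro h
    have := congrArg Complex.re h
    simp at this
  rw [div_eq_iff hne]
  apply Complex.ext
  · simp [Complex.mul_re]; nlinarith [hs]
  · simp [Complex.mul_im]; nlinarith [hs]

/-- **`t(c₃) = −27`** at the corner `c₃ = (3 + i√3)/6` (`t` is real and negative there, and
`t(c₃)² = t(W₃c₃)t(c₃) = 729` since `W₃c₃ = c₃ − 1`). [folklore] -/
theorem tThree_cmLevelThree : tThree cmLevelThree = -27 := by
  -- `t(c₃)² = 729`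
  have hper : tThree (frickeThree cmLevelThree) = tThree cmLevelThree := by
    rw [frickeThree_cmLevelThree', ← tThree_vadd_one ((-1 : ℝ) +ᵥ cmLevelThree), vadd_vadd]
    norm_num
  have hsq : tThree cmLevelThree * tThree cmLevelThree = 729 := by
    have := tThree_fricke cmLevelThree
    rwa [hper] at this
  -- `t(c₃)` is real and negative
  obtain ⟨hq1, hq3⟩ := cexp_cmLevelThree_real
  obtain ⟨him1, hre1⟩ := eta_tprod_real_pos cmLevelThree.im_pos hq1
  obtain ⟨him3, hre3⟩ := eta_tprod_real_pos (mulThree cmLevelThree).im_pos hq3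
  set P1 := ∏' n : ℕ, (1 - eta_q n ((cmLevelThree : ℍ) : ℂ)) with hP1
  set P3 := ∏' n : ℕ, (1 - eta_q n ((mulThree cmLevelThree : ℍ) : ℂ)) with hP3
  have hP1r : P1 = ((P1.re : ℝ) : ℂ) := Complex.ext rfl (by rw [him1]; rfl)
  have hP3r : P3 = ((P3.re : ℝ) : ℂ) := Complex.ext rfl (by rw [him3]; rfl)
  set s : ℝ := -Real.exp (π * Real.sqrt 3 / 3) * (P1.re / P3.re) ^ 12 with hs
  have hts : tThree cmLevelThree = (s : ℂ) := by
    rw [tThree_eq, cexp_neg_cmLevelThree, etaProd, etaProd, ← hP1, ← hP3, hP1r, hP3r, hs]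
    push_cast
    ring
  have hsneg : s < 0 := by
    rw [hs]
    have h1 : 0 < Real.exp (π * Real.sqrt 3 / 3) := Real.exp_pos _
    have h2 : 0 < (P1.re / P3.re) ^ 12 := by positivity
    nlinarith [mul_pos h1 h2]
  rw [hts] at hsq ⊢
  have hs2 : s * s = 729 := by exact_mod_cast hsq
  have : s = -27 := by nlinarith
  rw [this]; norm_num

end Literature.NumberTheory.ModularForms

end
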